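import Literature.AlgebraicGeometry.HodgeTheory.HodgeLociAnalyticCoverOfWeightTwoFrames
import Literature.AlgebraicGeometry.HodgeTheory.DirectImageBaseChangeContinuous
import Literature.AlgebraicGeometry.HodgeTheory.BettiUniverseIsoTransport
import Literature.AlgebraicGeometry.Motives.HodgeStructureAutGroupTransport
import Literature.AlgebraicGeometry.Motives.HodgeNumberFamilySemicontinuity
import Literature.NumberTheory.Transcendental.AnalytificationFunctorialityProofs
import HarnessLib

/-!
# Holomorphic frames of the Hodge bundles PULL BACK along a base change of the base
# (Voisin I §10.2.1: the period map of the pulled-back family is the composite; Griffiths 1968)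

Family `hodge`, layer `Literature/AlgebraicGeometry/HodgeTheory`. Theorems only (no definition, no named
fact). Written by the prover seat `hodge-nonav-prover-Ax` (g13, cell `hodge-nonav`), brick PENCIL-2a of the
programme «PENCIL» (route `HodgeConjecture/CyclicUnitaryPowers`, `--supports stmt-HodgeConjecture-19544`).

Setting: a smooth projective family `f : 𝒳 ⟶ S` over a smooth base (algebraic atlas `algebraicChart S m`), a
morphism of smooth `ℂ`-schemes `ι : P ⟶ S` (atlas `algebraicChart P m'`) and the base-changed family
`f' = familyPullback.snd f ι : 𝒳 ×_S P ⟶ P`. HYPOTHESIS `hF`: for `f`, near every point and for every reference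
state, holomorphic frames `w₂ i t` of `F^q Hᵏ` in flat coordinates, read in an ALGEBRAIC chart (exactly the
shape produced by `exists_topFormFrame_familySpz_chartAt` for hypersurface families, with `Good ψ` := «`ψ`
is `algebraicChart S m P₀` for some `P₀`»). CONCLUSION: the same for `f'`, with charts `algebraicChart P m' ·`
(shape of the hypothesis `hF2` of `hodgeLociAlternative_of_weightTwoFrames` ∕
`countable_setOf_not_isHodgeGenericPoint_of_weightTwoFrames_curve`, with that `Good`).

Mechanism: the fibre of `f'` over `t'` IS the fibre of `f` over `ι t'` (`fiberOverFamilyPullbackIso`); the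
flat transport of `f'` along `ε'` is that of `f` along `ι ∘ ε'` (the tree's
`FiberClass.baseChange_transportFun_of_isCohomologicallyLocallyTrivialOn`); the Hodge structures of isomorphic
fibres correspond (`BettiUniverse.hodge_eq_comapEquiv_of_iso`, model-independence
`HodgeModel.hodgeStructure_eq_hodge`); so the frame `t' ↦ (e_{s'}^*)⁻¹ w₂ i (ι t')` works, and it is
holomorphic in the algebraic chart of `P` because `ι(ℂ)` is holomorphic between the algebraic atlases
(GAGA, `mdifferentiable_comp_map_holds`) and `ℂ`-differentiable functions are analytic.

* `ofRatClass_pullEquiv` — `(e⁻¹)^*` on rational classes, complexified.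
* `exists_frames_familyPullback_chartAt` — the theorem.

Honest scope: a transfer lemma; nothing here says HC or any rung is proved.

## References

* [VoisinHodgeI2002] C. Voisin, Hodge Theory and Complex Algebraic Geometry I (2002), §9.2.1, §9.3 (local
  systems and base change), §10.2.1 Thm. 10.3.
* [Griffiths1968PeriodsII] P. Griffiths, Periods of integrals on algebraic manifolds II, Amer. J. Math. 90
  (1968), Thm. 1.1.
* [SerreGAGA1956] J.-P. Serre, Géométrie algébrique et géométrie analytique, §2 (fonctorialité).
-/

noncomputable section

open scoped Manifold ContDiff Topology TensorProduct
open CategoryTheory AlgebraicGeometry Set Filter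
open _root_.Topology
open Literature.NumberTheory.Transcendental Literature.AlgebraicGeometry.Motives
open Literature.AlgebraicTopology.SingularHomology
open Literature.AlgebraicGeometry.HodgeTheory.BettiUniverse

namespace Literature.AlgebraicGeometry.HodgeTheory

section BaseChange

variable {𝒳 S P : SchemeOver ℂ} (f : 𝒳 ⟶ S) (ι : P ⟶ S)

/-- `(e⁻¹)^*` on rational classes, complexified: `(pullEquiv e k v) ⊗ 1 = (e⁻¹)^* (v ⊗ 1)`.
[cite: VoisinHodgeI2002, §7.3.2] -/
theorem ofRatClass_pullEquiv {X X' : SchemeOver ℂ} (e : X ≅ X') (k : ℕ) (v : bettiCohomology X k) :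
    ofRatClass _ k (pullEquiv e k v) = complexBetti.map e.inv k (ofRatClass _ k v) := by
  rw [pullEquiv_apply]
  exact Motives.ofRatClass_map k (Motives.AlgPoints.mapContinuous (L := ℂ) e.inv) v

/-- **An algebraic morphism read in algebraic charts is holomorphic** (Serre, GAGA §2 n°5: the
coordinates of the target chart are regular functions, their pull-backs along `ι` are regular on an
open of `P`, and regular functions are `C^ω` in the algebraic charts of `P` — `algebraicChart_spec`):
`w ↦ (algebraicChart S m P₀) (ι ((algebraicChart P m' Q₀)⁻¹ w))` is analytic at every point `z` of the
chart target whose image lies in the source of the target chart. [cite: SerreGAGA1956, §2 n°5 Prop. 2 and p. 9 (fonctorialité)] -/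
theorem analyticAt_algebraicChart_map_algebraicChart_symm {m m' : ℕ}
    [AlgebraicGeometry.SmoothOfRelativeDimension m S.hom] [AlgebraicGeometry.LocallyOfFiniteType S.hom]
    [AlgebraicGeometry.SmoothOfRelativeDimension m' P.hom] [AlgebraicGeometry.LocallyOfFiniteType P.hom]
    (P₀ : ComplexPoints S) (Q₀ : ComplexPoints P) {z : Fin m' → ℂ}
    (hz : z ∈ (ComplexPoints.algebraicChart P m' Q₀).target)
    (hι : AlgPoints.map ι ((ComplexPoints.algebraicChart P m' Q₀).symm z) ∈
      (ComplexPoints.algebraicChart S m P₀).source) :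
    AnalyticAt ℂ (fun w ↦ (ComplexPoints.algebraicChart S m P₀
      (AlgPoints.map ι ((ComplexPoints.algebraicChart P m' Q₀).symm w)) : Fin m → ℂ)) z := by
  set c' := ComplexPoints.algebraicChart P m' Q₀ with hc'
  set cS := ComplexPoints.algebraicChart S m P₀ with hcS
  obtain ⟨⟨U, x, hsrcU, hx⟩, -⟩ := ComplexPoints.algebraicChart_spec S m P₀
  obtain ⟨-, holP⟩ := ComplexPoints.algebraicChart_spec P m' Q₀
  -- the point `Q = c'⁻¹ z` and an affine neighbourhood inside `ι⁻¹ U`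
  have hQU : (c'.symm z).pt ∈ ι.left ⁻¹ᵁ (U : S.left.Opens) := by
    change ι.left.base (c'.symm z).pt ∈ (U : S.left.Opens)
    have h := hsrcU hι
    simpa only [Set.mem_setOf_eq, AlgPoints.pt_map] using h
  obtain ⟨V, hVaff, hQV, hVU⟩ :=
    exists_isAffineOpen_mem_and_subset (X := P.left) (U := ι.left ⁻¹ᵁ (U : S.left.Opens)) hQU
  have hVU' : V ≤ ι.left ⁻¹ᵁ (U : S.left.Opens) := hVU
  -- the neighbourhood of `z` on which the three readings agree
  have hN : ∀ᶠ w in 𝓝 z, w ∈ c'.target ∧ (c'.symm w).pt ∈ V ∧ AlgPoints.map ι (c'.symm w) ∈ cS.source := by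
    have h1 : ∀ᶠ w in 𝓝 z, w ∈ c'.target := c'.open_target.mem_nhds hz
    have hcont : ContinuousAt c'.symm z := c'.continuousAt_symm hz
    have h2 : ∀ᶠ w in 𝓝 z, (c'.symm w).pt ∈ V :=
      hcont.preimage_mem_nhds ((AlgPoints.isOpen_setOf_pt_mem V).mem_nhds hQV)
    have h3 : ∀ᶠ w in 𝓝 z, AlgPoints.map ι (c'.symm w) ∈ cS.source :=
      hcont.preimage_mem_nhds (((cS.open_source.preimage (AlgPoints.continuous_map ι))).mem_nhds hι)
    exact (h1.and h2).and h3 |>.mono fun w h ↦ ⟨h.1.1, h.1.2, h.2⟩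
  refine analyticAt_pi_iff.2 fun i ↦ ?_
  -- the regular function `ι^* xᵢ` restricted to the affine `V`, holomorphic in the chart `c'`
  let s : Γ(P.left, V) := P.left.presheaf.map (homOfLE hVU').op (ι.left.app (U : S.left.Opens) (x i))
  have hhol : ContDiffOn ℂ ω (AlgPoints.evalOrZero V s ∘ c'.symm)
      (c'.target ∩ c'.symm ⁻¹' {R | R.pt ∈ V}) := holP ⟨V, hVaff⟩ s
  have hopen : IsOpen (c'.target ∩ c'.symm ⁻¹' {R : ComplexPoints P | R.pt ∈ V}) :=
    c'.isOpen_inter_preimage_symm (AlgPoints.isOpen_setOf_pt_mem V)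
  have hzA : AnalyticAt ℂ (AlgPoints.evalOrZero V s ∘ c'.symm) z :=
    (hhol.contDiffAt (hopen.mem_nhds ⟨hz, hQV⟩)).analyticAt
  refine hzA.congr (hN.mono fun w ⟨hw, hwV, hwS⟩ ↦ ?_)
  change AlgPoints.evalOrZero V s (c'.symm w) = cS (AlgPoints.map ι (c'.symm w)) i
  rw [hx _ hwS i, AlgPoints.evalOrZero_map, AlgPoints.evalOrZero_map_homOfLE hVU' _ hwV]

/-- **Holomorphic frames of the Hodge bundles pull back along a base change of the base** (see the module
docstring). For every base point `s'`, point `t₁'`, neighbourhood `N'` and reference identification `T₁'` of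
the base-changed family `f' = familyPullback.snd f ι`, there are a path-connected open `W₀' ∋ t₁'` inside
`N'`, a chart `ψ'` which IS the algebraic chart `algebraicChart P m' t₁'` (values, source, inverse), and
finitely many `w₂' i : W₀' → ℂ ⊗ Hᵏ(X'_{s'}; ℚ)` forming, along every continuation `T'` of `T₁'` inside `W₀'`,
a linearly independent frame of `F^q` of the transported Hodge structure, with holomorphic coordinates on
`ψ'(W₀')` — granted the same for `f` in algebraic charts (`hF`). [cite: VoisinHodgeI2002, §9.3 and §10.2.1 Thm. 10.3]
[cite: Griffiths1968PeriodsII, Thm. 1.1] [cite: SerreGAGA1956, §2 (fonctorialité)] -/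
theorem exists_frames_familyPullback_chartAt [HodgeTensorFacts.{0, 0}] {n m m' : ℕ} (k : ℕ) (q : ℤ)
    (hf : IsSmoothProjectiveFamily f n)
    [AlgebraicGeometry.SmoothOfRelativeDimension m S.hom] [AlgebraicGeometry.LocallyOfFiniteType S.hom]
    [AlgebraicGeometry.SmoothOfRelativeDimension m' P.hom] [AlgebraicGeometry.LocallyOfFiniteType P.hom]
    [AlgebraicGeometry.IsSeparated P.hom]
    (hU : IsCohomologicallyLocallyTrivialOn f (Set.univ : Set (ComplexPoints S)))
    (hU' : IsCohomologicallyLocallyTrivialOn (familyPullback.snd f ι) (Set.univ : Set (ComplexPoints P)))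
    (A : ∀ t : ComplexPoints S, HodgeModel n (fiberOver f t)) (hA : ∀ t, (A t).IsHodgeSymmetric)
    (A' : ∀ t' : ComplexPoints P, HodgeModel n (fiberOver (familyPullback.snd f ι) t'))
    (hA' : ∀ t', (A' t').IsHodgeSymmetric)
    (hF : ∀ (s t₁ : (Set.univ : Set (ComplexPoints S))), ∀ N ∈ 𝓝 t₁,
      ∀ (T₁ : singularCohomology ℚ ℚ (ComplexPoints (fiberOver f s.1)) k ≃ₗ[ℚ]
        singularCohomology ℚ ℚ (ComplexPoints (fiberOver f t₁.1)) k),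
      ∃ W₀ : Set (Set.univ : Set (ComplexPoints S)), IsOpen W₀ ∧ t₁ ∈ W₀ ∧ W₀ ⊆ N ∧ IsPathConnected W₀ ∧
      ∃ ψ : OpenPartialHomeomorph (Set.univ : Set (ComplexPoints S)) (Fin m → ℂ),
        (∃ P₀ : ComplexPoints S, (∀ t, (ψ t : Fin m → ℂ) = ComplexPoints.algebraicChart S m P₀ t.1) ∧
          (∀ t, t ∈ ψ.source ↔ t.1 ∈ (ComplexPoints.algebraicChart S m P₀).source) ∧
          (∀ z, ((ψ.symm z : (Set.univ : Set (ComplexPoints S))) : ComplexPoints S) =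
            (ComplexPoints.algebraicChart S m P₀).symm z)) ∧
        W₀ ⊆ ψ.source ∧
      ∃ (r₂ : ℕ) (w₂ : Fin r₂ → Set.Elem (Set.univ : Set (ComplexPoints S)) →
        ℂ ⊗[ℚ] singularCohomology ℚ ℚ (ComplexPoints (fiberOver f s.1)) k),
        (∀ t ∈ W₀, ∀ (ε' : Path t₁ t), (∀ r', ε' r' ∈ W₀) →
          ∀ (T : singularCohomology ℚ ℚ (ComplexPoints (fiberOver f s.1)) k ≃ₗ[ℚ]
            singularCohomology ℚ ℚ (ComplexPoints (fiberOver f t.1)) k),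
          (∀ v, ofRatClass _ k (T v) = transportFun f k hU ⟦ε'⟧ (ofRatClass _ k (T₁ v))) →
          LinearIndependent ℂ (fun i ↦ w₂ i t) ∧
            (((A t.1).hodgeStructure (hf.isSmoothProjective t.1) (hA t.1) k).comapEquiv T).F q =
              Submodule.span ℂ (Set.range fun i ↦ w₂ i t)) ∧
        (∀ (i : Fin r₂)
          (φ : Module.Dual ℂ (ℂ ⊗[ℚ] singularCohomology ℚ ℚ (ComplexPoints (fiberOver f s.1)) k)),
          AnalyticOnNhd ℂ (fun z ↦ φ (w₂ i (ψ.symm z))) (ψ '' W₀)))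
    (s' t₁' : (Set.univ : Set (ComplexPoints P))) (N' : Set (Set.univ : Set (ComplexPoints P)))
    (hN' : N' ∈ 𝓝 t₁')
    (T₁' : singularCohomology ℚ ℚ (ComplexPoints (fiberOver (familyPullback.snd f ι) s'.1)) k ≃ₗ[ℚ]
      singularCohomology ℚ ℚ (ComplexPoints (fiberOver (familyPullback.snd f ι) t₁'.1)) k) :
    ∃ W₀' : Set (Set.univ : Set (ComplexPoints P)), IsOpen W₀' ∧ t₁' ∈ W₀' ∧ W₀' ⊆ N' ∧ IsPathConnected W₀' ∧
    ∃ ψ' : OpenPartialHomeomorph (Set.univ : Set (ComplexPoints P)) (Fin m' → ℂ),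
      (∃ P₀' : ComplexPoints P, (∀ t, (ψ' t : Fin m' → ℂ) = ComplexPoints.algebraicChart P m' P₀' t.1) ∧
        (∀ t, t ∈ ψ'.source ↔ t.1 ∈ (ComplexPoints.algebraicChart P m' P₀').source) ∧
        (∀ z, ((ψ'.symm z : (Set.univ : Set (ComplexPoints P))) : ComplexPoints P) =
          (ComplexPoints.algebraicChart P m' P₀').symm z)) ∧
      W₀' ⊆ ψ'.source ∧
    ∃ (r₂ : ℕ) (w₂' : Fin r₂ → Set.Elem (Set.univ : Set (ComplexPoints P)) →
      ℂ ⊗[ℚ] singularCohomology ℚ ℚ (ComplexPoints (fiberOver (familyPullback.snd f ι) s'.1)) k),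
      (∀ t' ∈ W₀', ∀ (ε' : Path t₁' t'), (∀ r', ε' r' ∈ W₀') →
        ∀ (T' : singularCohomology ℚ ℚ (ComplexPoints (fiberOver (familyPullback.snd f ι) s'.1)) k ≃ₗ[ℚ]
          singularCohomology ℚ ℚ (ComplexPoints (fiberOver (familyPullback.snd f ι) t'.1)) k),
        (∀ v, ofRatClass _ k (T' v) =
          transportFun (familyPullback.snd f ι) k hU' ⟦ε'⟧ (ofRatClass _ k (T₁' v))) →
        LinearIndependent ℂ (fun i ↦ w₂' i t') ∧
          (((A' t'.1).hodgeStructure ((hf.familyPullback_snd ι).isSmoothProjective t'.1) (hA' t'.1)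
            k).comapEquiv T').F q = Submodule.span ℂ (Set.range fun i ↦ w₂' i t')) ∧
      (∀ (i : Fin r₂)
        (φ : Module.Dual ℂ (ℂ ⊗[ℚ] singularCohomology ℚ ℚ
          (ComplexPoints (fiberOver (familyPullback.snd f ι) s'.1)) k)),
        AnalyticOnNhd ℂ (fun z ↦ φ (w₂' i (ψ'.symm z))) (ψ' '' W₀')) := by
  classical
  -- ### notation and atlases
  have hf' : IsSmoothProjectiveFamily (familyPullback.snd f ι) n := hf.familyPullback_snd ι
  letI csS : ChartedSpace (Fin m → ℂ) (ComplexPoints S) :=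
    chartedSpaceOfCharts (ComplexPoints.algebraicChart S m) (ComplexPoints.mem_algebraicChart_source S m)
  letI csP : ChartedSpace (Fin m' → ℂ) (ComplexPoints P) :=
    chartedSpaceOfCharts (ComplexPoints.algebraicChart P m') (ComplexPoints.mem_algebraicChart_source P m')
  haveI : IsManifold 𝓘(ℂ, Fin m → ℂ) ω (ComplexPoints S) := isManifold_algebraicChart S m
  haveI : IsManifold 𝓘(ℂ, Fin m' → ℂ) ω (ComplexPoints P) := isManifold_algebraicChart P m'
  haveI : T2Space (ComplexPoints P) := ComplexPoints.t2Space_of_isSeparated P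
  haveI : LocallyPathConnectedSpace (ComplexPoints P) :=
    ChartedSpace.locallyPathConnectedSpace (Fin m' → ℂ) _
  haveI : LocallyPathConnectedSpace (Set.univ : Set (ComplexPoints P)) :=
    isOpen_univ.locallyPathConnectedSpace
  -- the map on `univ`-subtypes and the fibre identifications
  let ιu : Set.Elem (Set.univ : Set (ComplexPoints P)) → Set.Elem (Set.univ : Set (ComplexPoints S)) :=
    fun t' ↦ ⟨AlgPoints.map ι t'.1, Set.mem_univ _⟩
  have hιu : Continuous ιu :=
    ((AlgPoints.continuous_map ι).comp continuous_subtype_val).subtype_mk fun _ ↦ Set.mem_univ _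
  let e : ∀ x : ComplexPoints P, fiberOver (familyPullback.snd f ι) x ≅ fiberOver f (AlgPoints.map ι x) :=
    fun x ↦ fiberOverFamilyPullbackIso f ι x
  let E : ∀ x : ComplexPoints P, bettiCohomology (fiberOver (familyPullback.snd f ι) x) k ≃ₗ[ℚ]
      bettiCohomology (fiberOver f (AlgPoints.map ι x)) k := fun x ↦ pullEquiv (e x) k
  have hE : ∀ x (v : bettiCohomology (fiberOver (familyPullback.snd f ι) x) k),
      ofRatClass _ k (E x v) = complexBetti.map (e x).inv k (ofRatClass _ k v) :=
    fun x v ↦ ofRatClass_pullEquiv (e x) k v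
  -- ### the frames of `f` near `ι t₁'` for the transported reference state
  let s : Set.Elem (Set.univ : Set (ComplexPoints S)) := ιu s'
  let t₁ : Set.Elem (Set.univ : Set (ComplexPoints S)) := ιu t₁'
  let T₁ : bettiCohomology (fiberOver f s.1) k ≃ₗ[ℚ] bettiCohomology (fiberOver f t₁.1) k :=
    (E s'.1).symm.trans (T₁'.trans (E t₁'.1))
  obtain ⟨W₀, hW₀o, ht₁W₀, -, hW₀pc, ψ, ⟨P₀, hψa, hψs, hψy⟩, hW₀ψ, r₂, w₂, hw₂, hhol⟩ :=
    hF s t₁ Set.univ Filter.univ_mem T₁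
  -- ### the chart of `P` at `t₁'` and the neighbourhood `W₀'`
  set c' := ComplexPoints.algebraicChart P m' t₁'.1 with hc'
  let ψ' : OpenPartialHomeomorph (Set.univ : Set (ComplexPoints P)) (Fin m' → ℂ) :=
    (Homeomorph.Set.univ (ComplexPoints P)).transOpenPartialHomeomorph (chartAt (Fin m' → ℂ) t₁'.1)
  have hψ'a : ∀ t, (ψ' t : Fin m' → ℂ) = c' t.1 := fun t ↦ rfl
  have hψ'y : ∀ z, ((ψ'.symm z : (Set.univ : Set (ComplexPoints P))) : ComplexPoints P) = c'.symm z :=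
    fun z ↦ rfl
  have hψ's : ∀ t, t ∈ ψ'.source ↔ t.1 ∈ c'.source := fun t ↦ by
    rw [hc']
    change t ∈ ψ'.source ↔ t.1 ∈ (chartAt (Fin m' → ℂ) t₁'.1).source
    simp only [ψ', Homeomorph.transOpenPartialHomeomorph_source, Set.mem_preimage]
    rfl
  let O : Set (Set.univ : Set (ComplexPoints P)) := ψ'.source ∩ ιu ⁻¹' W₀ ∩ interior N'
  have hOo : IsOpen O := (ψ'.open_source.inter (hW₀o.preimage hιu)).inter isOpen_interior
  have ht₁'O : t₁' ∈ O :=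
    ⟨⟨(hψ's t₁').2 (ComplexPoints.mem_algebraicChart_source P m' t₁'.1), ht₁W₀⟩,
      mem_interior_iff_mem_nhds.2 hN'⟩
  set W₀' : Set (Set.univ : Set (ComplexPoints P)) := pathComponentIn O t₁' with hW₀'
  have hW₀'o : IsOpen W₀' := hOo.pathComponentIn t₁'
  have ht₁'W : t₁' ∈ W₀' := mem_pathComponentIn_self ht₁'O
  have hW₀'O : W₀' ⊆ O := pathComponentIn_subset
  have hW₀'pc : IsPathConnected W₀' := isPathConnected_pathComponentIn ht₁'O
  have hW₀'ψ : W₀' ⊆ ψ'.source := fun t ht ↦ (hW₀'O ht).1.1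
  have hW₀'W₀ : ∀ t' ∈ W₀', ιu t' ∈ W₀ := fun t ht ↦ (hW₀'O ht).1.2
  have hW₀'N : W₀' ⊆ N' := fun t ht ↦ interior_subset (hW₀'O ht).2
  -- ### the frame of `f'`
  let w₂' : Fin r₂ → Set.Elem (Set.univ : Set (ComplexPoints P)) →
      ℂ ⊗[ℚ] bettiCohomology (fiberOver (familyPullback.snd f ι) s'.1) k :=
    fun i t' ↦ ((E s'.1).baseChange ℚ ℂ _ _).symm (w₂ i (ιu t'))
  refine ⟨W₀', hW₀'o, ht₁'W, hW₀'N, hW₀'pc, ψ', ⟨t₁'.1, hψ'a, hψ's, hψ'y⟩, hW₀'ψ, r₂, w₂', ?_, ?_⟩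
  · -- ### frame property along a continuation `T'` of `T₁'` inside `W₀'`
    intro t' ht' ε' hε' T' hT'
    -- the image path and the transported identification of the `f`-fibres
    let γ : Path t₁ (ιu t') := ε'.map hιu
    have hγW : ∀ r, γ r ∈ W₀ := fun r ↦ hW₀'W₀ _ (hε' r)
    let T : bettiCohomology (fiberOver f s.1) k ≃ₗ[ℚ] bettiCohomology (fiberOver f (ιu t').1) k :=
      (E s'.1).symm.trans (T'.trans (E t'.1))
    -- `T` is the continuation of `T₁` along `γ` (base change of transports)
    have hT : ∀ v, ofRatClass _ k (T v) = transportFun f k hU ⟦γ⟧ (ofRatClass _ k (T₁ v)) := by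
      intro v
      set v' := (E s'.1).symm v with hv'
      have hbc := FiberClass.baseChange_transportFun_of_isCohomologicallyLocallyTrivialOn f ι hU hU' k
        γ ε' (fun u ↦ rfl) (ofRatClass _ k (T₁' v'))
        (α := complexBetti.map (e t₁'.1).inv k (ofRatClass _ k (T₁' v'))) rfl
      -- read the sigma-type identity on classes
      have hcls : transportFun f k hU ⟦γ⟧ (complexBetti.map (e t₁'.1).inv k (ofRatClass _ k (T₁' v'))) =
          complexBetti.map (e t'.1).inv k
            (transportFun (familyPullback.snd f ι) k hU' ⟦ε'⟧ (ofRatClass _ k (T₁' v'))) := by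
        simp only [FiberClass.baseChange, FiberClass.mk.injEq, heq_eq_eq] at hbc
        exact hbc.2
      have hTv : T v = E t'.1 (T' v') := rfl
      have hT₁v : T₁ v = E t₁'.1 (T₁' v') := rfl
      rw [hTv, hE, hT' v', ← hcls, hT₁v, hE]
    -- the frame of `f` at `ι t'`
    obtain ⟨hli, hspan⟩ := hw₂ (ιu t') (hW₀'W₀ t' ht') γ hγW T hT
    refine ⟨?_, ?_⟩
    · -- linear independence transfers along the linear equivalence
      exact hli.map' ((E s'.1).baseChange ℚ ℂ _ _).symm.toLinearMap
        (LinearMap.ker_eq_bot.2 ((E s'.1).baseChange ℚ ℂ _ _).symm.injective)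
    · -- the Hodge filtrations of the isomorphic fibres correspond
      have hHS' : (A' t'.1).hodgeStructure (hf'.isSmoothProjective t'.1) (hA' t'.1) k =
          ((A (ιu t').1).hodgeStructure (hf.isSmoothProjective (ιu t').1) (hA (ιu t').1) k).comapEquiv
            (E t'.1) := by
        rw [HodgeModel.hodgeStructure_eq_hodge exists_isReal_hodgeModel_holds
            hodgePQ_independent_of_hodgeModel_holds (hf'.isSmoothProjective t'.1) (A' t'.1) (hA' t'.1) k,
          HodgeModel.hodgeStructure_eq_hodge exists_isReal_hodgeModel_holds
            hodgePQ_independent_of_hodgeModel_holds (hf.isSmoothProjective (ιu t').1) (A (ιu t').1)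
            (hA (ιu t').1) k]
        exact hodge_eq_comapEquiv_of_iso exists_isReal_hodgeModel_holds hodgePQ_independent_of_hodgeModel_holds
          (hf'.isSmoothProjective t'.1) (hf.isSmoothProjective (ιu t').1) (e t'.1) k
      have htrans : T'.trans (E t'.1) = (E s'.1).trans T := by
        ext v
        simp only [LinearEquiv.trans_apply, LinearEquiv.symm_apply_apply, T]
      rw [hHS', ← HodgeStructure.comapEquiv_trans, htrans, HodgeStructure.comapEquiv_trans,
        HodgeStructure.comapEquiv_F, hspan, ← LinearEquiv.coe_baseChange,
        Submodule.comap_equiv_eq_map_symm, Submodule.map_span, ← Set.range_comp]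
      rfl
  · -- ### holomorphy in the algebraic chart of `P`
    intro i φ
    -- the composite chart map `G = ψ ∘ ι ∘ ψ'⁻¹`
    set cS := ComplexPoints.algebraicChart S m P₀ with hcS
    let G : (Fin m' → ℂ) → (Fin m → ℂ) := fun z ↦ cS (AlgPoints.map ι (c'.symm z))
    -- `G` is analytic: an algebraic morphism read in algebraic charts (GAGA)
    have hGan : AnalyticOnNhd ℂ G (ψ' '' W₀') := by
      rintro _ ⟨t', ht', rfl⟩
      have hzt : (ψ' t' : Fin m' → ℂ) ∈ c'.target := by
        rw [hψ'a]; exact c'.map_source ((hψ's t').1 (hW₀'ψ ht'))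
      have hsymm : c'.symm (ψ' t') = t'.1 := by
        rw [hψ'a]; exact c'.left_inv ((hψ's t').1 (hW₀'ψ ht'))
      have hιt : AlgPoints.map ι (c'.symm (ψ' t')) ∈ cS.source := by
        rw [hsymm]; exact (hψs (ιu t')).1 (hW₀ψ (hW₀'W₀ t' ht'))
      exact analyticAt_algebraicChart_map_algebraicChart_symm ι P₀ t₁'.1 hzt hιt
    have hGmaps : Set.MapsTo G (ψ' '' W₀') (ψ '' W₀) := by
      rintro _ ⟨t', ht', rfl⟩
      refine ⟨ιu t', hW₀'W₀ t' ht', ?_⟩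
      change ψ (ιu t') = cS (AlgPoints.map ι (c'.symm (ψ' t')))
      rw [hψa, hψ'a, c'.left_inv ((hψ's t').1 (hW₀'ψ ht'))]
    -- the coordinate of `w₂'` is the coordinate of `w₂` composed with `G`
    let φ'' : Module.Dual ℂ (ℂ ⊗[ℚ] bettiCohomology (fiberOver f s.1) k) :=
      φ ∘ₗ ((E s'.1).baseChange ℚ ℂ _ _).symm.toLinearMap
    have hcomp : ∀ z ∈ ψ' '' W₀', φ (w₂' i (ψ'.symm z)) = (fun y ↦ φ'' (w₂ i (ψ.symm y))) (G z) := by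
      rintro _ ⟨t', ht', rfl⟩
      have h1 : ψ'.symm (ψ' t') = t' := ψ'.left_inv (hW₀'ψ ht')
      have h2 : ψ.symm (G (ψ' t')) = ιu t' := by
        have : G (ψ' t') = ψ (ιu t') := by
          change cS (AlgPoints.map ι (c'.symm (ψ' t'))) = ψ (ιu t')
          rw [hψa, hψ'a, c'.left_inv ((hψ's t').1 (hW₀'ψ ht'))]
        rw [this, ψ.left_inv (hW₀ψ (hW₀'W₀ t' ht'))]
      simp only [h1, h2, w₂', φ'', LinearMap.coe_comp, Function.comp_apply, LinearEquiv.coe_coe]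
    refine (((hhol i φ'').comp hGan hGmaps)).congr (ψ'.isOpen_image_of_subset_source hW₀'o hW₀'ψ) ?_
    intro z hz
    exact (hcomp z hz).symm

end BaseChange

end Literature.AlgebraicGeometry.HodgeTheory

end
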